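import Mathlib.Analysis.Complex.UpperHalfPlane.Metric
import Mathlib.Analysis.Complex.UpperHalfPlane.MoebiusAction
import Mathlib.Analysis.Complex.UpperHalfPlane.ProperAction
import Mathlib.Topology.ContinuousMap.Compact
import Mathlib.Topology.UniformSpace.CompactConvergence
import Literature.Probability.RandomPlanarGeometry.CaratheodoryHalfPlane
import HarnessLib

/-!
# Möbius maps of the disc driven by `SL(2, ℝ)`, the Cayley transform and the hyperbolic metric

Support file for the explicit Möbius-invariant loop ensemble discharging the named fact
`Literature.Probability.RandomPlanarGeometry.exists_isCLEFamily` (`CLE.lean`): the ensemble lives in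
the upper half-plane `ℍ` and is transported to the unit disc by the Cayley transform
`C(z) = (z - i)/(z + i)` (`cayleyFun`, `CaratheodoryHalfPlane.lean`). Here:

* `diskMoebius g`, `g ∈ SL(2, ℝ)`: the disc automorphism `C ∘ g ∘ C⁻¹` given by the explicit formula
  `w ↦ -(p w + q) / (q̄ w + p̄)`, `p = (c - b) + (a + d) i`, `q = (c + b) + (a - d) i`, `|p|² - |q|² = 4`
  (`cayleyFun_smul : C (g • z) = diskMoebius g (C z)`); it is jointly continuous on
  `SL(2, ℝ) × closedBall 0 1` and `g ↦ diskMoebius g` is continuous for the uniform distance on the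
  closed disc (`tendstoUniformlyOn_diskMoebius`).
* The comparison between the hyperbolic metric of `ℍ` and the Euclidean metric of the disc:
  `‖C z - C w‖² = sinh² (d(z, w)/2) (1 - ‖C z‖²) (1 - ‖C w‖²)` (`norm_cayleyFun_sub_sq`), whence sets of
  bounded hyperbolic diameter near the unit circle are Euclidean-small (`norm_cayleyFun_sub_le`), and
  compactness of `{z ∈ ℍ : ‖C z‖ ≤ 1 - η}` (`isCompact_setOf_norm_cayleyFun_le`).
* The radial retraction `radialRetr z = z / max 1 ‖z‖` of `ℂ` onto the closed unit disc
  (`2`-Lipschitz), used to extend maps of the closed disc to uniformly continuous maps of `ℂ`.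

## References

* S. Lang, *SL₂(ℝ)*, GTM 105 (1985), Ch. I §1 (action on `ℍ`, Cayley transform to the disc).
* A. F. Beardon, *The Geometry of Discrete Groups*, GTM 91 (1983), §7.2 (the hyperbolic metrics of
  `ℍ` and of the disc; `sinh (d/2)` formulas).
-/

noncomputable section

open Set Filter Topology Complex Metric
open scoped MatrixGroups Real UpperHalfPlane

namespace Literature.Probability.RandomPlanarGeometry

/-! ### The radial retraction onto the closed unit disc -/

/-- The radial retraction `z ↦ z / max 1 ‖z‖` of `ℂ` onto the closed unit disc (the metric
projection onto the closed unit ball). [folklore] -/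
def radialRetr (z : ℂ) : ℂ := (((max 1 ‖z‖)⁻¹ : ℝ) : ℂ) * z

/-- `max 1 ‖z‖` is positive. [folklore] -/
lemma one_max_norm_pos (z : ℂ) : 0 < max 1 ‖z‖ := lt_max_of_lt_left one_pos

/-- The norm of the radial retraction: `‖z‖ / max 1 ‖z‖`. [folklore] -/
lemma norm_radialRetr (z : ℂ) : ‖radialRetr z‖ = ‖z‖ / max 1 ‖z‖ := by
  rw [radialRetr, norm_mul, norm_real, Real.norm_eq_abs, abs_of_pos (inv_pos.2 (one_max_norm_pos z)),
    inv_mul_eq_div]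

/-- The radial retraction takes values in the closed unit disc. [folklore] -/
lemma norm_radialRetr_le_one (z : ℂ) : ‖radialRetr z‖ ≤ 1 := by
  rw [norm_radialRetr, div_le_one (one_max_norm_pos z)]
  exact le_max_right _ _

/-- The radial retraction takes values in the closed unit disc. [folklore] -/
lemma radialRetr_mem_closedBall (z : ℂ) : radialRetr z ∈ closedBall (0 : ℂ) 1 :=
  mem_closedBall_zero_iff.2 (norm_radialRetr_le_one z)

/-- The radial retraction fixes the closed unit disc. [folklore] -/
lemma radialRetr_of_norm_le_one {z : ℂ} (hz : ‖z‖ ≤ 1) : radialRetr z = z := by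
  rw [radialRetr, max_eq_left hz, inv_one, ofReal_one, one_mul]

/-- Outside the unit disc the radial retraction is `z / ‖z‖`. [folklore] -/
lemma radialRetr_of_one_le_norm {z : ℂ} (hz : 1 ≤ ‖z‖) :
    radialRetr z = ((‖z‖⁻¹ : ℝ) : ℂ) * z := by
  rw [radialRetr, max_eq_right hz]

/-- The range of the radial retraction is the closed unit disc. [folklore] -/
lemma range_radialRetr : range radialRetr = closedBall (0 : ℂ) 1 :=
  Subset.antisymm (range_subset_iff.2 radialRetr_mem_closedBall) fun z hz ↦
    ⟨z, radialRetr_of_norm_le_one (mem_closedBall_zero_iff.1 hz)⟩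

/-- **The radial retraction is `2`-Lipschitz.** [folklore] -/
lemma lipschitzWith_radialRetr : LipschitzWith 2 radialRetr := by
  -- the one-sided estimate `‖r z - r w‖ ≤ 2 ‖z - w‖` when `‖w‖ ≤ ‖z‖`
  have key : ∀ z w : ℂ, ‖w‖ ≤ ‖z‖ → ‖radialRetr z - radialRetr w‖ ≤ 2 * ‖z - w‖ := by
    intro z w hwz
    rcases le_or_gt ‖z‖ 1 with hz | hz
    · rw [radialRetr_of_norm_le_one hz, radialRetr_of_norm_le_one (hwz.trans hz)]
      linarith [norm_nonneg (z - w)]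
    have hz0 : 0 < ‖z‖ := one_pos.trans hz
    have hzz : ((‖z‖⁻¹ : ℝ) : ℂ) * z - z = (((‖z‖⁻¹ - 1 : ℝ)) : ℂ) * z := by
      push_cast; ring
    have h1 : ‖((‖z‖⁻¹ : ℝ) : ℂ) * z - z‖ = ‖z‖ - 1 := by
      rw [hzz, norm_mul, norm_real, Real.norm_eq_abs, abs_of_nonpos (by
        rw [sub_nonpos]; exact inv_le_one_of_one_le₀ hz.le), neg_sub, sub_mul,
        inv_mul_cancel₀ hz0.ne', one_mul]
    rcases le_or_gt ‖w‖ 1 with hw | hw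
    · rw [radialRetr_of_one_le_norm hz.le, radialRetr_of_norm_le_one hw]
      calc ‖((‖z‖⁻¹ : ℝ) : ℂ) * z - w‖ ≤ ‖((‖z‖⁻¹ : ℝ) : ℂ) * z - z‖ + ‖z - w‖ := norm_sub_le_norm_sub_add_norm_sub _ _ _
        _ = (‖z‖ - 1) + ‖z - w‖ := by rw [h1]
        _ ≤ (‖z‖ - ‖w‖) + ‖z - w‖ := by linarith
        _ ≤ ‖z - w‖ + ‖z - w‖ := by linarith [norm_sub_norm_le z w]
        _ = 2 * ‖z - w‖ := by ring
    · have hw0 : 0 < ‖w‖ := one_pos.trans hw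
      rw [radialRetr_of_one_le_norm hz.le, radialRetr_of_one_le_norm hw.le]
      have e1 : ((‖z‖⁻¹ : ℝ) : ℂ) * z - ((‖w‖⁻¹ : ℝ) : ℂ) * w =
          ((‖z‖⁻¹ : ℝ) : ℂ) * (z - w) + (((‖z‖⁻¹ - ‖w‖⁻¹ : ℝ)) : ℂ) * w := by
        push_cast; ring
      rw [e1]
      calc ‖((‖z‖⁻¹ : ℝ) : ℂ) * (z - w) + (((‖z‖⁻¹ - ‖w‖⁻¹ : ℝ)) : ℂ) * w‖
          ≤ ‖((‖z‖⁻¹ : ℝ) : ℂ) * (z - w)‖ + ‖(((‖z‖⁻¹ - ‖w‖⁻¹ : ℝ)) : ℂ) * w‖ := norm_add_le _ _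
        _ = ‖z‖⁻¹ * ‖z - w‖ + |‖z‖⁻¹ - ‖w‖⁻¹| * ‖w‖ := by
          rw [norm_mul, norm_mul, norm_real, norm_real, Real.norm_eq_abs, Real.norm_eq_abs,
            abs_of_pos (inv_pos.2 hz0)]
        _ = ‖z‖⁻¹ * ‖z - w‖ + ‖z‖⁻¹ * (‖z‖ - ‖w‖) := by
          congr 1
          rw [abs_of_nonpos (sub_nonpos.2 (inv_anti₀ hw0 hwz)), neg_sub, sub_mul,
            inv_mul_cancel₀ hw0.ne', mul_sub, ← div_eq_inv_mul, ← div_eq_inv_mul, div_self hz0.ne']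
        _ ≤ ‖z‖⁻¹ * ‖z - w‖ + ‖z‖⁻¹ * ‖z - w‖ := by
          gcongr
          exact norm_sub_norm_le z w
        _ = 2 * (‖z‖⁻¹ * ‖z - w‖) := by ring
        _ ≤ 2 * (1 * ‖z - w‖) := by
          gcongr
          exact inv_le_one_of_one_le₀ hz.le
        _ = 2 * ‖z - w‖ := by ring
  refine LipschitzWith.of_dist_le_mul fun z w ↦ ?_
  rw [dist_eq_norm, dist_eq_norm, NNReal.coe_ofNat]
  rcases le_total ‖w‖ ‖z‖ with h | h
  · exact key z w h
  · rw [norm_sub_rev (radialRetr z), norm_sub_rev z]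
    exact key w z h

/-- The radial retraction is uniformly continuous. [folklore] -/
lemma uniformContinuous_radialRetr : UniformContinuous radialRetr :=
  lipschitzWith_radialRetr.uniformContinuous

/-- The radial retraction is continuous. [folklore] -/
@[fun_prop] lemma continuous_radialRetr : Continuous radialRetr :=
  lipschitzWith_radialRetr.continuous

/-- A map continuous on the closed unit disc, precomposed with the radial retraction, is uniformly
continuous on `ℂ` (it factors through the compact disc). [folklore] -/
lemma uniformContinuous_comp_radialRetr {Φ : ℂ → ℂ} (hΦ : ContinuousOn Φ (closedBall 0 1)) :
    UniformContinuous (Φ ∘ radialRetr) := by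
  have hu : UniformContinuousOn Φ (closedBall 0 1) :=
    (isCompact_closedBall 0 1).uniformContinuousOn_of_continuous hΦ
  rw [← uniformContinuousOn_univ]
  refine hu.comp (uniformContinuous_radialRetr.uniformContinuousOn (s := univ)) ?_
  exact fun z _ ↦ radialRetr_mem_closedBall z

/-- A map continuous on the closed unit disc, precomposed with the radial retraction, is
continuous on `ℂ`. [folklore] -/
lemma continuous_comp_radialRetr {Φ : ℂ → ℂ} (hΦ : ContinuousOn Φ (closedBall 0 1)) :
    Continuous (Φ ∘ radialRetr) :=
  (uniformContinuous_comp_radialRetr hΦ).continuous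

/-! ### The disc Möbius map driven by `g ∈ SL(2, ℝ)` -/

section DiskMoebius

variable (g : SL(2, ℝ))

/-- The coefficient `p = (c - b) + (a + d) i` of `diskMoebius g`, `g = (a b; c d)`. [folklore] -/
def dmP : ℂ := ((g 1 0 - g 0 1 : ℝ) : ℂ) + ((g 0 0 + g 1 1 : ℝ) : ℂ) * I

/-- The coefficient `q = (c + b) + (a - d) i` of `diskMoebius g`. [folklore] -/
def dmQ : ℂ := ((g 1 0 + g 0 1 : ℝ) : ℂ) + ((g 0 0 - g 1 1 : ℝ) : ℂ) * I

/-- The conjugate coefficient `p̄`. [folklore] -/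
def dmPc : ℂ := ((g 1 0 - g 0 1 : ℝ) : ℂ) - ((g 0 0 + g 1 1 : ℝ) : ℂ) * I

/-- The conjugate coefficient `q̄`. [folklore] -/
def dmQc : ℂ := ((g 1 0 + g 0 1 : ℝ) : ℂ) - ((g 0 0 - g 1 1 : ℝ) : ℂ) * I

/-- **The disc Möbius map driven by `g ∈ SL(2, ℝ)`**: `w ↦ -(p w + q) / (q̄ w + p̄)`, the conjugate
`C ∘ g ∘ C⁻¹` of the Möbius action of `g` on `ℍ` by the Cayley transform (`cayleyFun_smul`)
(Lang, *SL₂(ℝ)*, Ch. I §1). [folklore] -/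
def diskMoebius (w : ℂ) : ℂ := -(dmP g * w + dmQ g) / (dmQc g * w + dmPc g)

/-- `|p|² - |q|² = 4 (ad - bc) = 4`. [folklore] -/
lemma normSq_dmP_sub_normSq_dmQ : normSq (dmP g) - normSq (dmQ g) = 4 := by
  have hdet : g 0 0 * g 1 1 - g 0 1 * g 1 0 = 1 := by
    have := Matrix.SpecialLinearGroup.det_coe g
    rwa [Matrix.det_fin_two] at this
  simp only [dmP, dmQ, normSq_apply, add_re, ofReal_re, mul_re, I_re, mul_zero, ofReal_im, I_im,
    mul_one, sub_self, add_zero, add_im, mul_im, zero_add]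
  nlinarith [hdet]

/-- `|p̄| = |p|`. [folklore] -/
lemma normSq_dmPc : normSq (dmPc g) = normSq (dmP g) := by
  simp only [dmP, dmPc, normSq_apply, add_re, sub_re, ofReal_re, mul_re, I_re, I_im, ofReal_im, add_im,
    sub_im, mul_im]
  ring

/-- `|q̄| = |q|`. [folklore] -/
lemma normSq_dmQc : normSq (dmQc g) = normSq (dmQ g) := by
  simp only [dmQ, dmQc, normSq_apply, add_re, sub_re, ofReal_re, mul_re, I_re, I_im, ofReal_im, add_im,
    sub_im, mul_im]
  ring

/-- `‖q‖ < ‖p‖`. [folklore] -/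
lemma norm_dmQ_lt_norm_dmP : ‖dmQ g‖ < ‖dmP g‖ := by
  have h := normSq_dmP_sub_normSq_dmQ g
  rw [normSq_eq_norm_sq, normSq_eq_norm_sq] at h
  nlinarith [norm_nonneg (dmQ g), norm_nonneg (dmP g)]

/-- The denominator of `diskMoebius g` does not vanish on the closed unit disc:
`‖q̄ w + p̄‖ ≥ ‖p‖ - ‖q‖ > 0`. [folklore] -/
lemma norm_den_pos {w : ℂ} (hw : ‖w‖ ≤ 1) : 0 < ‖dmQc g * w + dmPc g‖ := by
  have hP : ‖dmPc g‖ = ‖dmP g‖ := by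
    rw [← Real.sqrt_sq (norm_nonneg (dmPc g)), ← Real.sqrt_sq (norm_nonneg (dmP g)),
      ← normSq_eq_norm_sq, ← normSq_eq_norm_sq, normSq_dmPc]
  have hQ : ‖dmQc g‖ = ‖dmQ g‖ := by
    rw [← Real.sqrt_sq (norm_nonneg (dmQc g)), ← Real.sqrt_sq (norm_nonneg (dmQ g)),
      ← normSq_eq_norm_sq, ← normSq_eq_norm_sq, normSq_dmQc]
  have h1 : ‖dmPc g‖ - ‖dmQc g * w‖ ≤ ‖dmQc g * w + dmPc g‖ := by
    have := norm_sub_norm_le (dmPc g) (-(dmQc g * w))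
    rw [norm_neg, sub_neg_eq_add, add_comm] at this
    exact this
  have h2 : ‖dmQc g * w‖ ≤ ‖dmQ g‖ := by
    rw [norm_mul, hQ]
    exact mul_le_of_le_one_right (norm_nonneg _) hw
  linarith [norm_dmQ_lt_norm_dmP g]

/-- The denominator of `diskMoebius g` does not vanish on the closed unit disc. [folklore] -/
lemma den_ne_zero {w : ℂ} (hw : ‖w‖ ≤ 1) : dmQc g * w + dmPc g ≠ 0 :=
  norm_pos_iff.1 (norm_den_pos g hw)

/-- Numerator identity: `p (z - i) + q (z + i) = 2i ((a z + b) - i (c z + d))`. [folklore] -/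
lemma dmP_mul_add (z : ℂ) :
    dmP g * (z - I) + dmQ g * (z + I) =
      2 * I * (((g 0 0 : ℝ) : ℂ) * z + (g 0 1 : ℝ) - I * (((g 1 0 : ℝ) : ℂ) * z + (g 1 1 : ℝ))) := by
  apply Complex.ext <;> simp [dmP, dmQ] <;> ring

/-- Denominator identity: `q̄ (z - i) + p̄ (z + i) = -2i ((a z + b) + i (c z + d))`. [folklore] -/
lemma dmQc_mul_add (z : ℂ) :
    dmQc g * (z - I) + dmPc g * (z + I) =
      -(2 * I) * (((g 0 0 : ℝ) : ℂ) * z + (g 0 1 : ℝ) + I * (((g 1 0 : ℝ) : ℂ) * z + (g 1 1 : ℝ))) := by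
  apply Complex.ext <;> simp [dmPc, dmQc] <;> ring

/-- **The disc Möbius map is the Cayley conjugate of the Möbius action on `ℍ`**:
`C (g • z) = diskMoebius g (C z)` for `z ∈ ℍ` (Lang, *SL₂(ℝ)*, Ch. I §1). [folklore] -/
theorem cayleyFun_smul (z : UpperHalfPlane) :
    cayleyFun ((g • z : UpperHalfPlane) : ℂ) = diskMoebius g (cayleyFun z) := by
  set a : ℂ := ((g 0 0 : ℝ) : ℂ) with ha
  set b : ℂ := ((g 0 1 : ℝ) : ℂ) with hb
  set c : ℂ := ((g 1 0 : ℝ) : ℂ) with hc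
  set d : ℂ := ((g 1 1 : ℝ) : ℂ) with hd
  have hcoe : ((g • z : UpperHalfPlane) : ℂ) = (a * z + b) / (c * z + d) := by
    rw [UpperHalfPlane.coe_specialLinearGroup_apply]; rfl
  have hD : c * z + d ≠ 0 := by
    have h := z.im_pos
    intro h0
    -- the imaginary part of `c z + d` is `c · im z`; if it vanishes then `c = 0`, `d = 0`, det `= 0`
    have him : (g 1 0 : ℝ) * z.im = 0 := by
      have := congrArg Complex.im h0
      simpa [hc, hd] using this
    have hre : (g 1 0 : ℝ) * z.re + g 1 1 = 0 := by
      have := congrArg Complex.re h0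
      simpa [hc, hd] using this
    have hc0 : (g 1 0 : ℝ) = 0 := by
      rcases mul_eq_zero.1 him with h1 | h1
      · exact h1
      · exact absurd h1 h.ne'
    have hd0 : (g 1 1 : ℝ) = 0 := by simpa [hc0] using hre
    have hdet := Matrix.SpecialLinearGroup.det_coe g
    rw [Matrix.det_fin_two, hc0, hd0] at hdet
    simp at hdet
  have hzI : (z : ℂ) + I ≠ 0 := add_I_ne_zero z.im_pos.le
  have hgzI : ((g • z : UpperHalfPlane) : ℂ) + I ≠ 0 := add_I_ne_zero (g • z).im_pos.le
  -- `N + i D ≠ 0` where `g • z = N / D`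
  have hND : a * z + b + I * (c * z + d) ≠ 0 := by
    intro h0
    apply hgzI
    rw [hcoe, div_add' _ _ _ hD, h0, zero_div]
  have e1 : (a * z + b) / (c * z + d) - I = (a * z + b - I * (c * z + d)) / (c * z + d) := by
    rw [eq_div_iff hD, sub_mul, div_mul_cancel₀ _ hD]
  have e2 : (a * z + b) / (c * z + d) + I = (a * z + b + I * (c * z + d)) / (c * z + d) := by
    rw [eq_div_iff hD, add_mul, div_mul_cancel₀ _ hD]
  have e3 : dmQc g * ((z - I) / (z + I)) + dmPc g =
      (dmQc g * (z - I) + dmPc g * (z + I)) / (z + I) := by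
    field_simp
  have e4 : -(dmP g * ((z - I) / (z + I)) + dmQ g) =
      -(dmP g * (z - I) + dmQ g * (z + I)) / (z + I) := by
    field_simp
  have h2I : (2 : ℂ) * I ≠ 0 := mul_ne_zero two_ne_zero I_ne_zero
  rw [diskMoebius, cayleyFun_apply, cayleyFun_apply, hcoe, e1, e2, e3, e4, dmP_mul_add, dmQc_mul_add,
    div_div_div_cancel_right₀ hD, div_div_div_cancel_right₀ hzI, neg_mul, neg_div_neg_eq,
    mul_div_mul_left _ _ h2I]

/-- The entries of `g ∈ SL(2, ℝ)` depend continuously on `g`. [folklore] -/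
lemma continuous_entry (i j : Fin 2) : Continuous fun g : SL(2, ℝ) ↦ (g i j : ℝ) :=
  (continuous_subtype_val (p := fun A : Matrix (Fin 2) (Fin 2) ℝ ↦ A.det = 1)).matrix_elem i j

/-- `p` depends continuously on `g`. [folklore] -/
@[fun_prop] lemma continuous_dmP : Continuous (dmP : SL(2, ℝ) → ℂ) := by
  unfold dmP; fun_prop [continuous_entry]

/-- `q` depends continuously on `g`. [folklore] -/
@[fun_prop] lemma continuous_dmQ : Continuous (dmQ : SL(2, ℝ) → ℂ) := by
  unfold dmQ; fun_prop [continuous_entry]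

/-- `p̄` depends continuously on `g`. [folklore] -/
@[fun_prop] lemma continuous_dmPc : Continuous (dmPc : SL(2, ℝ) → ℂ) := by
  unfold dmPc; fun_prop [continuous_entry]

/-- `q̄` depends continuously on `g`. [folklore] -/
@[fun_prop] lemma continuous_dmQc : Continuous (dmQc : SL(2, ℝ) → ℂ) := by
  unfold dmQc; fun_prop [continuous_entry]

/-- The disc Möbius map is jointly continuous in `(g, w)` on `SL(2, ℝ) × closedBall 0 1`. [folklore] -/
theorem continuousOn_diskMoebius_uncurry :
    ContinuousOn (fun p : SL(2, ℝ) × ℂ ↦ diskMoebius p.1 p.2) (univ ×ˢ closedBall 0 1) := by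
  have hnum : Continuous fun p : SL(2, ℝ) × ℂ ↦ -(dmP p.1 * p.2 + dmQ p.1) := by
    fun_prop
  have hden : Continuous fun p : SL(2, ℝ) × ℂ ↦ dmQc p.1 * p.2 + dmPc p.1 := by
    fun_prop
  exact hnum.continuousOn.div hden.continuousOn fun p hp ↦
    den_ne_zero p.1 (mem_closedBall_zero_iff.1 hp.2)

/-- The disc Möbius map is jointly continuous in `(g, w)` on `SL(2, ℝ) ×` the closed unit disc
(as a subtype). [folklore] -/
theorem continuous_diskMoebius_restrict :
    Continuous fun p : SL(2, ℝ) × closedBall (0 : ℂ) 1 ↦ diskMoebius p.1 (p.2 : ℂ) := by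
  have hnum : Continuous fun p : SL(2, ℝ) × closedBall (0 : ℂ) 1 ↦ -(dmP p.1 * (p.2 : ℂ) + dmQ p.1) := by
    fun_prop
  have hden : Continuous fun p : SL(2, ℝ) × closedBall (0 : ℂ) 1 ↦ dmQc p.1 * (p.2 : ℂ) + dmPc p.1 := by
    fun_prop
  exact hnum.div hden fun p ↦ den_ne_zero p.1 (mem_closedBall_zero_iff.1 p.2.2)

/-- The disc Möbius maps restricted to the closed unit disc, as a continuous map of `(g, w)`. [folklore] -/
def diskMoebiusCM : C(SL(2, ℝ) × closedBall (0 : ℂ) 1, ℂ) :=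
  ⟨fun p ↦ diskMoebius p.1 p.2, continuous_diskMoebius_restrict⟩

/-- Unfolding `diskMoebiusCM`. [folklore] -/
@[simp] lemma diskMoebiusCM_apply (p : SL(2, ℝ) × closedBall (0 : ℂ) 1) :
    diskMoebiusCM p = diskMoebius p.1 p.2 := rfl

/-- **The disc Möbius maps depend continuously on `g` for the uniform distance on the closed disc**
(joint continuity on `SL(2, ℝ) ×` a compact set). [folklore] -/
theorem tendstoUniformlyOn_diskMoebius (g₀ : SL(2, ℝ)) :
    TendstoUniformlyOn (fun g w ↦ diskMoebius g w) (diskMoebius g₀) (𝓝 g₀) (closedBall 0 1) := by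
  haveI : CompactSpace (closedBall (0 : ℂ) 1) := isCompact_iff_compactSpace.1 (isCompact_closedBall 0 1)
  have h := (ContinuousMap.tendsto_iff_tendstoUniformly.1
    (diskMoebiusCM.curry.continuous.tendsto g₀))
  rw [tendstoUniformlyOn_iff_tendstoUniformly_comp_coe]
  exact h

/-- For `g` near `g₀`, `diskMoebius g` is uniformly `ε`-close to `diskMoebius g₀` on the closed disc. [folklore] -/
theorem eventually_forall_dist_diskMoebius_lt (g₀ : SL(2, ℝ)) {ε : ℝ} (hε : 0 < ε) :
    ∀ᶠ g in 𝓝 g₀, ∀ w ∈ closedBall (0 : ℂ) 1, dist (diskMoebius g w) (diskMoebius g₀ w) < ε := by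
  filter_upwards [Metric.tendstoUniformlyOn_iff.1 (tendstoUniformlyOn_diskMoebius g₀) ε hε] with g hg
  intro w hw
  rw [dist_comm]
  exact hg w hw

/-- The disc Möbius map is continuous on the closed unit disc. [folklore] -/
theorem continuousOn_diskMoebius : ContinuousOn (diskMoebius g) (closedBall 0 1) := by
  have hnum : Continuous fun w : ℂ ↦ -(dmP g * w + dmQ g) := by fun_prop
  have hden : Continuous fun w : ℂ ↦ dmQc g * w + dmPc g := by fun_prop
  exact hnum.continuousOn.div hden.continuousOn fun w hw ↦ den_ne_zero g (mem_closedBall_zero_iff.1 hw)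

/-- The disc Möbius map extended from the closed disc by the radial retraction is uniformly
continuous on `ℂ`. [folklore] -/
theorem uniformContinuous_diskMoebius_comp_radialRetr :
    UniformContinuous (diskMoebius g ∘ radialRetr) :=
  uniformContinuous_comp_radialRetr (continuousOn_diskMoebius g)

/-- The disc Möbius map extended by the radial retraction, as a continuous map of `ℂ`. [folklore] -/
def diskMoebiusExt : C(ℂ, ℂ) :=
  ⟨diskMoebius g ∘ radialRetr, (uniformContinuous_diskMoebius_comp_radialRetr g).continuous⟩

/-- Unfolding `diskMoebiusExt`. [folklore] -/
@[simp] lemma diskMoebiusExt_apply (w : ℂ) : diskMoebiusExt g w = diskMoebius g (radialRetr w) := rfl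

/-- On the closed disc `diskMoebiusExt g` is `diskMoebius g`. [folklore] -/
lemma diskMoebiusExt_of_norm_le_one {w : ℂ} (hw : ‖w‖ ≤ 1) : diskMoebiusExt g w = diskMoebius g w := by
  rw [diskMoebiusExt_apply, radialRetr_of_norm_le_one hw]

/-- `diskMoebiusExt g` is uniformly continuous. [folklore] -/
lemma uniformContinuous_diskMoebiusExt : UniformContinuous (diskMoebiusExt g) :=
  uniformContinuous_diskMoebius_comp_radialRetr g

end DiskMoebius

/-! ### The Cayley transform: hyperbolic versus Euclidean distances -/

section Cayley

/-- `1 - ‖C z‖² = 4 im z / ‖z + i‖²` for `z ∈ ℍ`. [folklore] -/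
theorem one_sub_norm_cayleyFun_sq (z : ℍ) :
    (1 : ℝ) - ‖cayleyFun z‖ ^ 2 = 4 * z.im / ‖(z : ℂ) + I‖ ^ 2 := by
  have hzI : (z : ℂ) + I ≠ 0 := add_I_ne_zero z.im_pos.le
  have hpos : 0 < ‖(z : ℂ) + I‖ ^ 2 := by positivity
  rw [cayleyFun_apply, norm_div, div_pow, eq_div_iff hpos.ne', sub_mul, div_mul_cancel₀ _ hpos.ne',
    one_mul, ← normSq_eq_norm_sq, ← normSq_eq_norm_sq]
  have := normSq_add_I_sub_normSq_sub_I z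
  rw [UpperHalfPlane.coe_im] at this
  linarith

/-- `C z - C w = 2i (z - w) / ((z + i)(w + i))`. [folklore] -/
theorem cayleyFun_sub_cayleyFun (z w : ℍ) :
    cayleyFun z - cayleyFun w = 2 * I * ((z : ℂ) - w) / (((z : ℂ) + I) * ((w : ℂ) + I)) := by
  have hzI : (z : ℂ) + I ≠ 0 := add_I_ne_zero z.im_pos.le
  have hwI : (w : ℂ) + I ≠ 0 := add_I_ne_zero w.im_pos.le
  rw [cayleyFun_apply, cayleyFun_apply, div_sub_div _ _ hzI hwI]
  congr 1
  ring

/-- **Euclidean distance in the disc versus hyperbolic distance in `ℍ`**: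
`‖C z - C w‖² = sinh² (d(z,w)/2) · (1 - ‖C z‖²) (1 - ‖C w‖²)` (Beardon 1983, §7.2). [folklore] -/
theorem norm_cayleyFun_sub_sq (z w : ℍ) :
    ‖cayleyFun z - cayleyFun w‖ ^ 2 =
      Real.sinh (dist z w / 2) ^ 2 * ((1 - ‖cayleyFun z‖ ^ 2) * (1 - ‖cayleyFun w‖ ^ 2)) := by
  rw [UpperHalfPlane.sinh_half_dist, one_sub_norm_cayleyFun_sq, one_sub_norm_cayleyFun_sq, cayleyFun_sub_cayleyFun,
    norm_div, norm_mul, norm_mul, norm_mul, Complex.norm_two, norm_I, mul_one, div_pow, div_pow,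
    mul_pow, mul_pow, mul_pow, Real.sq_sqrt (mul_pos z.im_pos w.im_pos).le, dist_eq_norm]
  have hz : 0 < ‖(z : ℂ) + I‖ := norm_pos_iff.2 (add_I_ne_zero z.im_pos.le)
  have hw : 0 < ‖(w : ℂ) + I‖ := norm_pos_iff.2 (add_I_ne_zero w.im_pos.le)
  have hy := z.im_pos
  have hy' := w.im_pos
  field_simp
  ring

/-- **Sets of bounded hyperbolic diameter near the unit circle are Euclidean-small**:
`‖C z - C w‖ ≤ sinh (d(z,w)/2) √(2 (1 - ‖C z‖))`. [folklore] -/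
theorem norm_cayleyFun_sub_le (z w : ℍ) :
    ‖cayleyFun z - cayleyFun w‖ ≤ Real.sinh (dist z w / 2) * Real.sqrt (2 * (1 - ‖cayleyFun z‖)) := by
  have hs : 0 ≤ Real.sinh (dist z w / 2) := Real.sinh_nonneg_iff.2 (by positivity)
  have hcz : ‖cayleyFun z‖ ≤ 1 := norm_cayleyFun_le_one z.im_pos.le
  have hcw : ‖cayleyFun w‖ ≤ 1 := norm_cayleyFun_le_one w.im_pos.le
  have h1 : (1 - ‖cayleyFun z‖ ^ 2) * (1 - ‖cayleyFun w‖ ^ 2) ≤ 2 * (1 - ‖cayleyFun z‖) := by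
    have h0 : 0 ≤ 1 - ‖cayleyFun z‖ ^ 2 := by nlinarith [norm_nonneg (cayleyFun z)]
    have h0' : 1 - ‖cayleyFun w‖ ^ 2 ≤ 1 := by nlinarith [norm_nonneg (cayleyFun w)]
    calc (1 - ‖cayleyFun z‖ ^ 2) * (1 - ‖cayleyFun w‖ ^ 2) ≤ (1 - ‖cayleyFun z‖ ^ 2) * 1 :=
          mul_le_mul_of_nonneg_left h0' h0
      _ ≤ 2 * (1 - ‖cayleyFun z‖) := by nlinarith [norm_nonneg (cayleyFun z)]
  have h2 : ‖cayleyFun z - cayleyFun w‖ ^ 2 ≤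
      (Real.sinh (dist z w / 2) * Real.sqrt (2 * (1 - ‖cayleyFun z‖))) ^ 2 := by
    rw [norm_cayleyFun_sub_sq, mul_pow, Real.sq_sqrt (by linarith)]
    exact mul_le_mul_of_nonneg_left h1 (sq_nonneg _)
  exact le_of_sq_le_sq h2 (mul_nonneg hs (Real.sqrt_nonneg _))

/-- The point of `ℍ` with Cayley image `w`, `‖w‖ < 1`. [folklore] -/
def ofDisc (w : ℂ) (hw : ‖w‖ < 1) : ℍ := ⟨cayleyInvFun w, cayleyInvFun_im_pos hw⟩

/-- The coordinate of `ofDisc w hw` is `C⁻¹ w`. [folklore] -/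
@[simp] lemma coe_ofDisc (w : ℂ) (hw : ‖w‖ < 1) : ((ofDisc w hw : ℍ) : ℂ) = cayleyInvFun w := rfl

/-- `C (ofDisc w) = w`. [folklore] -/
lemma cayleyFun_ofDisc (w : ℂ) (hw : ‖w‖ < 1) : cayleyFun (ofDisc w hw : ℍ) = w := by
  rw [coe_ofDisc, cayleyFun_cayleyInvFun]
  rintro rfl
  simp at hw

/-- `ofDisc (C z) = z`. [folklore] -/
lemma ofDisc_cayleyFun (z : ℍ) (h : ‖cayleyFun z‖ < 1) : ofDisc (cayleyFun z) h = z :=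
  UpperHalfPlane.ext (by rw [coe_ofDisc, cayleyInvFun_cayleyFun (add_I_ne_zero z.im_pos.le)])

/-- The Cayley image of a point of `ℍ` lies in the open unit disc. [folklore] -/
lemma norm_cayleyFun_coe_lt_one (z : ℍ) : ‖cayleyFun z‖ < 1 :=
  (norm_cayleyFun_lt_one_iff (add_I_ne_zero z.im_pos.le)).2 z.im_pos

/-- The map `w ↦ ofDisc w` is continuous on the closed disc of radius `1 - η`, `η > 0`
(as a map of the subtype). [folklore] -/
lemma continuous_ofDisc_restrict {η : ℝ} (hη : 0 < η) :
    Continuous fun w : closedBall (0 : ℂ) (1 - η) ↦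
      ofDisc (w : ℂ) ((mem_closedBall_zero_iff.1 w.2).trans_lt (by linarith)) := by
  rw [UpperHalfPlane.isEmbedding_coe.continuous_iff]
  change Continuous fun w : closedBall (0 : ℂ) (1 - η) ↦ cayleyInvFun (w : ℂ)
  refine differentiableOn_cayleyInvFun.continuousOn.comp_continuous continuous_subtype_val fun w ↦ ?_
  have hw : ‖(w : ℂ)‖ < 1 := (mem_closedBall_zero_iff.1 w.2).trans_lt (by linarith)
  rintro (h1 : (w : ℂ) = 1)
  simp [h1] at hw

/-- **The part of `ℍ` whose Cayley image stays `η` away from the unit circle is compact**: it is the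
image of the closed disc of radius `1 - η` under `C⁻¹`. [folklore] -/
theorem isCompact_setOf_norm_cayleyFun_le {η : ℝ} (hη : 0 < η) :
    IsCompact {z : ℍ | ‖cayleyFun z‖ ≤ 1 - η} := by
  haveI : CompactSpace (closedBall (0 : ℂ) (1 - η)) :=
    isCompact_iff_compactSpace.1 (isCompact_closedBall 0 (1 - η))
  have hrange : {z : ℍ | ‖cayleyFun z‖ ≤ 1 - η} = range (fun w : closedBall (0 : ℂ) (1 - η) ↦
      ofDisc (w : ℂ) ((mem_closedBall_zero_iff.1 w.2).trans_lt (by linarith))) := by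
    ext z
    simp only [mem_setOf_eq, mem_range]
    constructor
    · intro hz
      refine ⟨⟨cayleyFun z, mem_closedBall_zero_iff.2 hz⟩, ?_⟩
      exact ofDisc_cayleyFun z _
    · rintro ⟨w, rfl⟩
      rw [cayleyFun_ofDisc]
      exact mem_closedBall_zero_iff.1 w.2
  rw [hrange]
  exact isCompact_range (continuous_ofDisc_restrict hη)

end Cayley

end Literature.Probability.RandomPlanarGeometry
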